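import Summits.Parity.GeneralizedHardyLittlewood.Theorems.LeeYangFibresCellParityLawKernelDefs
import Literature.NumberTheory.Sieve.LinearEquationsInPrimesCrudeBounds
import Literature.NumberTheory.Sieve.SieveFramework
import HarnessLib

/-!
# Route `LeeYangFibres`, crux `CellParityLaw` (stmt-Parity-14109), line `section-annihilator`:
# the Type-I-side identities `SectionSeqBFacts` of the section sequence `secSeqB`

Proof of the registered stub `stub_sectionSeqBFacts : SectionSeqBFacts` of skeleton v13 (elementary
double counting and unfolding, no analytic input). For the section sequence in Bombieri's normalisation
`secSeqB Ψ K N u i j'` (weights `b(q) = sectionWeight … q`, size the counting function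
`A(y) = ∑_{0 < q ≤ y} b(q)`, density `g = sectionDensityFn Ψ i`):

* (a) `A(y) = A_1(y)` (the filter `1 ∣ ·` is trivial);
* (b) `A_d(y) = sectionMass Ψ (K ∩ {ψ_i ≤ y}) … d`: classify the lattice points of the truncated
  section mass by the value `q = ψ_i(n)`; the fibre at `q` IS the fibre `{ψ_i = q}` counted by `b(q)`,
  and `0 < q`, `(q : ℝ) ≤ y ↔ q ≤ ⌊y⌋₊`;
* (c) hence `R_d(y) = sectionMass … d - g(d) · sectionMass … 1` on that body for `d ≠ 0`;
* (d) once `x` bounds every value of `ψ_i` on the box, the truncation at `x` is vacuous, so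
  `A(x) = F⁽ⁱ⁾_{j'} = sectionMass Ψ K … 1`;
* (e) `V(z) = ∏_{p < z} (1 - g(p))` (the prime factors of `P(z)` are the primes `< z`);
* (f), (g) the bodies `K ∩ {ψ_i ≤ y}`, `K ∩ {T < ψ_i}` are convex when `K` is (sublevel and
  superlevel sets of an affine function are half-spaces).

The counting lemmas are stated for an abstract body `K'` characterised on the lattice points of the box
(so that the decidability instances of `sectionMass` are shared) and then specialised to
`K' = K ∩ {ψ_i ≤ y}`.
-/

noncomputable section

open scoped BigOperators Classical
open Finset Literature.NumberTheory.Sieve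

namespace Summit.Parity.GeneralizedHardyLittlewood.Cruxes.CellParityLaw.SectionAnnihilator

namespace SeqBFactsAux

variable {t : ℕ} (Ψ : Fin (t + 1) → AffLinForm 1) (K : Set (Fin 1 → ℝ)) (N u : ℕ) (i : Fin (t + 1))
  (j' : Fin t → ℕ)

/-- The sublevel sets `{x : ψ(x) ≤ c}` of an affine-linear form are convex (a closed half-space of
the linear part). -/
theorem convex_realEval_le {d : ℕ} (ψ : AffLinForm d) (c : ℝ) :
    Convex ℝ {x : Fin d → ℝ | ψ.realEval x ≤ c} := by
  have h : {x : Fin d → ℝ | ψ.realEval x ≤ c} =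
      {x : Fin d → ℝ | ∑ j, (ψ.coeff j : ℝ) * x j ≤ c - ψ.const} := by
    ext x
    simp only [Set.mem_setOf_eq, AffLinForm.realEval]
    constructor <;> intro h <;> linarith
  rw [h]
  exact convex_halfSpace_le ψ.isLinearMap_realLinearPart _

/-- **(a).** The size of `secSeqB` is its first congruence sum (the filter `1 ∣ ·` is trivial). -/
theorem size_eq_congrSum_one (y : ℝ) :
    (secSeqB Ψ K N u i j').size y = (secSeqB Ψ K N u i j').congrSum 1 y := by
  rw [SieveSequence.congrSum, Finset.filter_true_of_mem fun n _ => one_dvd n]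
  rfl

/-- **(b), over `ℕ`, abstract body.** If on the lattice points of the box the body `K'` is cut out of
`K` by `ψ_i ≤ y`, then `∑_{0 < q ≤ y, d ∣ q} b(q)` is the section mass of `K'` at the modulus `d`:
classify the points of the latter by the value `q = ψ_i(n)`; the fibre at `q` IS the fibre `{ψ_i = q}`
of the section weight (`0 < q`, and `(q : ℝ) ≤ y ↔ q ≤ ⌊y⌋₊`). (`d = 0` is allowed: both sides vanish.)
The index finset `T` is abstract to share decidability instances with `SieveSequence.congrSum`. -/
theorem sum_sectionWeight_eq_sectionMass_of_iff {K' : Set (Fin 1 → ℝ)} (d : ℕ) (y : ℝ)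
    (hK' : ∀ n ∈ latticeBox 1 N,
      (realPoint n ∈ K' ↔ realPoint n ∈ K ∧ (((Ψ i).eval n : ℤ) : ℝ) ≤ y))
    (T : Finset ℕ) (hT : ∀ q, q ∈ T ↔ (0 < q ∧ q ≤ ⌊y⌋₊) ∧ d ∣ q) :
    ∑ q ∈ T, sectionWeight Ψ K N u i j' q = sectionMass Ψ K' N u i j' d := by
  unfold sectionMass
  rw [Finset.card_eq_sum_card_fiberwise (f := fun n => ((Ψ i).eval n).toNat) (t := T)]
  · refine Finset.sum_congr rfl fun q hq => ?_
    obtain ⟨⟨hq0, hqy⟩, hdq⟩ := (hT q).mp hq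
    unfold sectionWeight
    congr 1
    ext n
    simp only [Finset.mem_filter]
    constructor
    · rintro ⟨hbox, hK, hev, hfr⟩
      refine ⟨⟨hbox, (hK' n hbox).mpr ⟨hK, ?_⟩, ?_, ?_, hfr⟩, ?_⟩
      · rw [hev, Int.cast_natCast]
        exact (Nat.le_floor_iff' hq0.ne').mp hqy
      · rw [hev]
        exact_mod_cast hq0
      · rw [hev]
        exact Int.natCast_dvd_natCast.mpr hdq
      · rw [hev, Int.toNat_natCast]
    · rintro ⟨⟨hbox, hK, hpos, -, hfr⟩, hfq⟩
      refine ⟨hbox, ((hK' n hbox).mp hK).1, ?_, hfr⟩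
      omega
  · intro n hn
    simp only [Finset.mem_coe, Finset.mem_filter] at hn
    obtain ⟨hbox, hK, hpos, hdvd, -⟩ := hn
    obtain ⟨-, hy⟩ := (hK' n hbox).mp hK
    obtain ⟨m, hm⟩ := Int.eq_ofNat_of_zero_le hpos.le
    rw [hm] at hdvd hpos hy
    rw [Int.cast_natCast] at hy
    show ((Ψ i).eval n).toNat ∈ T
    rw [hm, Int.toNat_natCast, hT]
    exact ⟨⟨by exact_mod_cast hpos, Nat.le_floor hy⟩, Int.natCast_dvd_natCast.mp hdvd⟩

/-- **(b).** The congruence sums of `secSeqB` truncated at `y` are the section masses over the convex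
body `K ∩ {ψ_i ≤ y}`. -/
theorem congrSum_eq (d : ℕ) (y : ℝ) :
    (secSeqB Ψ K N u i j').congrSum d y =
      sectionMass Ψ (K ∩ {v | (Ψ i).realEval v ≤ y}) N u i j' d := by
  rw [SieveSequence.congrSum, ← sum_sectionWeight_eq_sectionMass_of_iff Ψ K N u i j'
    (K' := K ∩ {v | (Ψ i).realEval v ≤ y}) d y
    (fun n _ => by rw [Set.mem_inter_iff, Set.mem_setOf_eq, realEval_realPoint])
    ((Ioc 0 ⌊y⌋₊).filter (d ∣ ·)) (fun q => by rw [Finset.mem_filter, Finset.mem_Ioc]), Nat.cast_sum]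
  rfl

/-- **(c).** The truncated remainders of `secSeqB` at `d ≠ 0` are the atom's discrepancies on the body
`K ∩ {ψ_i ≤ y}` (by (a), (b) and `sectionDensityFn_apply`). -/
theorem remainder_eq {d : ℕ} (y : ℝ) (hd : d ≠ 0) :
    (secSeqB Ψ K N u i j').remainder d y =
      (sectionMass Ψ (K ∩ {v | (Ψ i).realEval v ≤ y}) N u i j' d : ℝ) -
        sectionDensity Ψ i d * (sectionMass Ψ (K ∩ {v | (Ψ i).realEval v ≤ y}) N u i j' 1 : ℝ) := by
  rw [SieveSequence.remainder, congrSum_eq, size_eq_congrSum_one, congrSum_eq]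
  change _ - sectionDensityFn Ψ i d * _ = _
  rw [sectionDensityFn_apply Ψ i hd]

/-- **(d), abstract body.** Two bodies with the same lattice points in the box have the same section
masses. -/
theorem sectionMass_congr_body {K' : Set (Fin 1 → ℝ)}
    (hK' : ∀ n ∈ latticeBox 1 N, (realPoint n ∈ K' ↔ realPoint n ∈ K)) (d : ℕ) :
    sectionMass Ψ K' N u i j' d = sectionMass Ψ K N u i j' d := by
  unfold sectionMass
  congr 1
  exact Finset.filter_congr fun n hn => and_congr (hK' n hn) Iff.rfl

/-- **(e).** The density product of `secSeqB` over `P(z)` is `∏_{p < z} (1 - g(p))`. -/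
theorem densityProduct_secSeqB (z : ℝ) :
    (secSeqB Ψ K N u i j').densityProduct (primesProdBelow z) =
      ∏ p ∈ Nat.primesBelow ⌈z⌉₊, (1 - sectionDensity Ψ i p) := by
  unfold SieveSequence.densityProduct
  rw [primeFactors_primesProdBelow]
  refine Finset.prod_congr rfl fun p hp => ?_
  have hp' : p.Prime := Nat.prime_of_mem_primesBelow hp
  change 1 - sectionDensityFn Ψ i p = _
  rw [sectionDensityFn_apply Ψ i hp'.ne_zero]

end SeqBFactsAux

open SeqBFactsAux in
/-- **`stub_sectionSeqBFacts`** (registered stub of skeleton v13, line `section-annihilator`): the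
Type-I-side identities `SectionSeqBFacts` of the section sequence in Bombieri's normalisation — (a) the
size is the counting function; (b) the congruence sums truncated at `y` are the section masses over the
convex body `K ∩ {ψ_i ≤ y}`; (c) hence the truncated remainders at `d ≠ 0` are the atom's discrepancies on
that body; (d) once `x` bounds the values of `ψ_i` on the box, `A(x)` is the fibre mass `F⁽ⁱ⁾_{j'}`;
(e) `V(z) = ∏_{p<z} (1 - g(p))`; (f), (g) the bodies `K ∩ {ψ_i ≤ y}`, `K ∩ {T < ψ_i}` are convex when
`K` is. Elementary. -/
theorem stub_sectionSeqBFacts : SectionSeqBFacts := by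
  intro t Ψ K N u i j'
  refine ⟨size_eq_congrSum_one Ψ K N u i j', congrSum_eq Ψ K N u i j',
    fun d y hd => remainder_eq Ψ K N u i j' y hd, fun x hx => ?_, densityProduct_secSeqB Ψ K N u i j',
    fun y hK => hK.inter (convex_realEval_le (Ψ i) y),
    fun T hK => hK.inter ((Ψ i).convex_realEval_gt T)⟩
  rw [size_eq_congrSum_one, congrSum_eq, sectionMass_congr_body Ψ K N u i j'
    (K' := K ∩ {v | (Ψ i).realEval v ≤ x})
    (fun n hn => by
      rw [Set.mem_inter_iff, Set.mem_setOf_eq, realEval_realPoint]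
      exact and_iff_left (hx n hn)) 1]

end Summit.Parity.GeneralizedHardyLittlewood.Cruxes.CellParityLaw.SectionAnnihilator

end
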